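import Literature.MathematicalPhysics.QuantumFieldTheory.VortexTwistSignFlip
import Literature.MathematicalPhysics.QuantumFieldTheory.StrongCouplingActivities
import HarnessLib

/-!
# Tomboulis's mod-2 rule for vortex twists: the twisted `SU(2)` partition function depends only on
# the twist set modulo coboundaries (Haar invariance under `U_b ↦ -U_b`)

Topic `Literature/MathematicalPhysics/QuantumFieldTheory`, in the vocabulary of
`TomboulisVortexDecimation.lean` (namespace `Tomboulis2007`: `SU2`, `su2Char`, `plaqFn`, `plaqFnTwist`,
`torusZ`, `torusZtw`, `vortexSheet`, `vortexRatio`, `scaleCoeff`) and of `ConstructiveQFTWave0.lean`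
(`Site`, `Edge`, `Plaquette`, `GaugeConfig`, `plaquetteHolonomy`, `haarProbability`). Theorems, plus the
auxiliary definitions they are about (the central element `-𝟙`, the link flip, the mod-2 coboundary of a
link set, translated vortex sheets); no new fact.

E. T. Tomboulis, *Confinement for all values of the coupling in four-dimensional SU(2) gauge theory*,
arXiv:0707.2179 [Tomboulis2007Confinement], §4, p. 12, text following eq. (4.1): "the twisted partition
function depends only on the directions in which `𝒱_{μν}` winds through the lattice, not the exact shape
or location of `𝒱_{μν}`. This expresses the mod 2 conservation of flux. Indeed, a twist `τ_{μν} = -1` on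
the plaquettes forming a coclosed set `𝒱_{μν}` can be moved to the plaquettes forming any other homologous
coclosed set `𝒱'` by the change of variables `U_b → -U_b` for each bond `b` in a set of bonds cobounded by
`𝒱 ∪ 𝒱'`, leaving `Z_Λ(τ_{μν}, β)` invariant. By the same token, `Z_Λ(τ_{μν}, β)` is invariant under
changes mod 2 in the number of homologous coclosed sets in `Λ` carrying a twist." (Used again in App. A,
p. 22: "`Z⁻` does not depend on the location but only the homology class of `𝒱`".) This is the
measure-theoretic half of the census parity law that `VortexTwistSignFlip.lean` left open; it is proved
here for Tomboulis's character-truncated model at every spin cut-off `J`, every coefficient sequence `c`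
(no sign or size condition) and every torus `(ℤ/Lℤ)^d`:

* `negOne : SU2` is `-𝟙`; it is central, an involution, and `χ_j(-U) = (-1)^{2j} χ_j(U)`
  (`su2Char_negOne_mul`, from Mathlib's parity of the Chebyshev polynomials `U_n`), so `f(-U)` is the
  twisted plaquette function and `f⁻(-U) = f(U)` (`plaqFn_negOne_mul`, `plaqFnTwist_negOne_mul`).
* `flipLinks E` is the change of variables `U_b ↦ -U_b` (`b ∈ E`); it preserves the product Haar measure
  (`measurePreserving_flipLinks`: left translation link by link, Mathlib `measurePreserving_pi`) and
  multiplies the holonomy of the plaquette `p` by `(-𝟙)^{k_p(E)}`, `k_p(E)` the number of boundary slots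
  of `p` in `E` (`plaquetteHolonomy_flipLinks`, `plaqSign_eq_pow`); `coboundary E` is the set of
  plaquettes with `k_p(E)` odd — the cellular mod-2 coboundary `δE` (slots counted with multiplicity, so
  that the degenerate tori `L = 1, 2` need no separate treatment), additive under symmetric difference
  (`coboundary_symmDiff`).
* **The rule** (`torusZtw_symmDiff_coboundary`, `torusZtw_congr_coboundary`): `Z⁻_{V ∆ δE} = Z⁻_V` for
  every plaquette set `V` and link set `E`; in particular a twist carried by a coboundary is invisible
  (`torusZtw_coboundary`).
* **Location independence and cancellation in pairs** for the parallel sheets `vortexSheetAt L a i j`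
  (all `(i, j)`-plaquettes at `x_i = a`, `x_j = 0`; `a = 0` is `vortexSheet`): the `j`-links between two
  adjacent sheets have exactly that pair as coboundary (`coboundary_sheetLinks`), hence
  `Z⁻_{sheet at a} = Z⁻_{sheet at 0}` (`torusZtw_vortexSheetAt`) and `Z⁻_{sheet a ∆ sheet b} = Z`
  (`torusZtw_two_parallel_sheets`).
* **Even tori**: for `2 ∣ L` the set of ALL plaquettes is a coboundary (of the "odd staircase" of links
  `(x, m)` with `x₀ + ⋯ + x_{m-1}` odd, which meets every plaquette in one or three slots, in every
  dimension — a variant of Li–Meurice's line set meeting every plaquette exactly once, `D ≤ 4`: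
  `coboundary_oddStaircase`), so `Z⁻_{Vᶜ} = Z⁻_V` and `Z⁻_{all} = Z` (`torusZtw_compl_of_even`,
  `torusZtw_univ_of_even`); combined with `torusZtw_negOdd` of `VortexTwistSignFlip.lean` this is the
  centre symmetry of the coefficients, `Z⁻_V({(-1)^{2j} c_j}) = Z⁻_V({c_j})`, `Z({(-1)^{2j} c_j}) = Z({c_j})`
  (`torusZtw_negOdd_of_even`, `torusZ_negOdd_of_even`) — Li–Meurice's `β ↦ -β` symmetry of `SU(2)`
  lattice gauge theory on even lattices (Phys. Rev. D 71 (2005) 016008, §4) in Tomboulis's normalisation —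
  and on the one-character ray `Z(-s) = Z(s)`, `Z⁻_V(-s) = Z⁻_V(s)`, `(Z⁻/Z)(-s) = (Z⁻/Z)(s)`
  (`torusZ_one_scaleCoeff_neg_of_even`, `torusZtw_one_scaleCoeff_neg_of_even`,
  `vortexRatio_one_scaleCoeff_neg_of_even`): the evenness rows of the exact small-volume census
  (cell pub-ymgap, lit/LIT2-TOMBOULIS-ITOSEILER.md §I) on the isotropic even tori `2³`, `4³`, `2⁴`.

HONEST FRAMING: identities between finite-dimensional Haar integrals on finite tori; nothing about signs,
monotonicity, the disputed inequality (5.15), confinement or any limit. Not here: the odd-`L` companion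
(`Z(-s)` = the partition function twisted on one sheet in every coordinate plane), coclosedness of twist
sets, the `ℤ/2` cohomology of the torus as such.

## References
* [Tomboulis2007Confinement] E. T. Tomboulis, Confinement for all values of the coupling in
  four-dimensional SU(2) gauge theory, arXiv:0707.2179, §4 (text after (4.1)), eqs. (4.1)–(4.4); App. A.
* [LiMeurice2004] L. Li, Y. Meurice, Lattice gluodynamics at negative g², Phys. Rev. D 71 (2005) 016008,
  arXiv:hep-lat/0410029, §4.
-/

noncomputable section

open MeasureTheory Finset Real
open scoped BigOperators symmDiff
open Literature.MathematicalPhysics.QuantumLattice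

namespace Literature.MathematicalPhysics.QuantumFieldTheory

namespace Tomboulis2007

/-! ### The central element `-𝟙 ∈ SU(2)` and the characters at `-U` -/

/-- The non-trivial central element `-𝟙` of `SU(2)` (`det(-𝟙) = (-1)² = 1`); Tomboulis's only
non-trivial twist `τ_{μν} = -1` (arXiv:0707.2179 §4: "In the case of SU(2) … there is only one nontrivial
element, `τ_{μν} = -1`"). [folklore] -/
def negOne : SU2 :=
  ⟨-1, by
    rw [Matrix.mem_specialUnitaryGroup_iff]
    refine ⟨?_, ?_⟩
    · rw [Matrix.mem_unitaryGroup_iff]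
      simp
    · simp [Matrix.det_neg, Fintype.card_fin]⟩

/-- The underlying matrix of `negOne` is `-1`. [folklore] -/
@[simp] private theorem coe_negOne : ((negOne : SU2) : Matrix (Fin 2) (Fin 2) ℂ) = -1 := rfl

/-- `-𝟙 · U` has underlying matrix `-U`. [folklore] -/
private theorem coe_negOne_mul (U : SU2) :
    ((negOne * U : SU2) : Matrix (Fin 2) (Fin 2) ℂ) = -(U : Matrix (Fin 2) (Fin 2) ℂ) := by
  rw [Submonoid.coe_mul, coe_negOne, neg_one_mul]

/-- `-𝟙` is an involution: the centre of `SU(2)` is `Z(2) = {±𝟙}` (arXiv:0707.2179 §4: "for group SU(N), it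
introduces vortex flux characterized by elements of `π₁(SU(N)/Z(N)) = Z(N)`").
[cite: Tomboulis2007Confinement, §4 (text after eq. (4.1))] -/
theorem negOne_mul_negOne : negOne * negOne = (1 : SU2) := by
  apply Subtype.ext
  rw [Submonoid.coe_mul, coe_negOne, Submonoid.coe_one]
  simp

/-- `-𝟙` is central — the twist is "an element of the group center" (arXiv:0707.2179 §4, before (4.1)).
[cite: Tomboulis2007Confinement, §4 (text before eq. (4.1))] -/
theorem negOne_mul_comm (U : SU2) : negOne * U = U * negOne := by
  apply Subtype.ext
  rw [Submonoid.coe_mul, Submonoid.coe_mul, coe_negOne]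
  simp

/-- `(-𝟙)⁻¹ = -𝟙`. [folklore] -/
private theorem negOne_inv : (negOne : SU2)⁻¹ = negOne := by
  rw [inv_eq_iff_mul_eq_one, negOne_mul_negOne]

/-- `(-U)⁻¹ = -U⁻¹`. [folklore] -/
private theorem negOne_mul_inv (U : SU2) : (negOne * U)⁻¹ = negOne * U⁻¹ := by
  rw [mul_inv_rev, negOne_inv, negOne_mul_comm]

/-- **`χ_j(-U) = (-1)^{2j} χ_j(U)`** (arXiv:0707.2179 §4 eq. (4.4): under the twist "only half-integer
representations … are affected"): with `n = 2j`, `χ_n(-U) = U_n(-cos θ) = (-1)^n U_n(cos θ)` by the parity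
of the Chebyshev polynomials of the second kind (Mathlib `Polynomial.Chebyshev.U_eval_neg`).
[cite: Tomboulis2007Confinement, §4 eq. (4.4)] -/
theorem su2Char_negOne_mul (n : ℕ) (U : SU2) :
    su2Char n (negOne * U) = (-1 : ℝ) ^ n * su2Char n U := by
  unfold su2Char
  rw [coe_negOne_mul, Matrix.trace_neg, Complex.neg_re, neg_div, Polynomial.Chebyshev.U_eval_neg,
    Int.cast_negOnePow_natCast]

/-- The plaquette function at `-U` is the twisted plaquette function at `U`: `f(-U) = f⁻(U)`
(arXiv:0707.2179 eqs. (4.1), (4.4): `A_p(U_p) → A_p(τ U_p)`, `f_p(U_p) → f_p(-U_p)`).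
[cite: Tomboulis2007Confinement, §4 eqs. (4.1)–(4.4)] -/
theorem plaqFn_negOne_mul (J : ℕ) (c : ℕ → ℝ) (U : SU2) :
    plaqFn J c (negOne * U) = plaqFnTwist J c U := by
  unfold plaqFn plaqFnTwist
  congr 1
  refine Finset.sum_congr rfl fun n _ => ?_
  rw [su2Char_negOne_mul]
  ring

/-- The twisted plaquette function at `-U` is the untwisted one at `U`: `f⁻(-U) = f(U)` (the twist is an
involution). [cite: Tomboulis2007Confinement, §4 eqs. (4.1)–(4.4)] -/
theorem plaqFnTwist_negOne_mul (J : ℕ) (c : ℕ → ℝ) (U : SU2) :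
    plaqFnTwist J c (negOne * U) = plaqFn J c U := by
  unfold plaqFn plaqFnTwist
  congr 1
  refine Finset.sum_congr rfl fun n _ => ?_
  rw [su2Char_negOne_mul]
  have h : (-1 : ℝ) ^ n * (-1 : ℝ) ^ n = 1 := by
    rw [← mul_pow]; norm_num
  calc (-1 : ℝ) ^ n * ((n : ℝ) + 1) * c n * ((-1 : ℝ) ^ n * su2Char n U)
      = ((-1 : ℝ) ^ n * (-1 : ℝ) ^ n) * (((n : ℝ) + 1) * c n * su2Char n U) := by ring
    _ = ((n : ℝ) + 1) * c n * su2Char n U := by rw [h, one_mul]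

/-! ### The change of variables `U_b ↦ -U_b` on a set of links -/

variable {d L : ℕ}

/-- The sign carried by a link under the flip along `E`: `-𝟙` on the links of `E`, `𝟙` elsewhere.
[cite: Tomboulis2007Confinement, §4 (text after (4.1): the change of variables `U_b → -U_b`)] -/
def linkSign (E : Finset (Edge d L)) (e : Edge d L) : SU2 := if e ∈ E then negOne else 1

/-- **Tomboulis's change of variables** `U_b ↦ -U_b` for the bonds `b ∈ E` (all other link variables
unchanged). [cite: Tomboulis2007Confinement, §4 (text after (4.1))] -/
def flipLinks (E : Finset (Edge d L)) (U : GaugeConfig d L SU2) : GaugeConfig d L SU2 :=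
  fun e => linkSign E e * U e

/-- Each link sign is an involution. [folklore] -/
private theorem linkSign_mul_linkSign (E : Finset (Edge d L)) (e : Edge d L) :
    linkSign E e * linkSign E e = 1 := by
  unfold linkSign
  split_ifs
  · exact negOne_mul_negOne
  · exact one_mul 1

/-- Each link sign is central. [folklore] -/
private theorem linkSign_mul_comm (E : Finset (Edge d L)) (e : Edge d L) (U : SU2) :
    linkSign E e * U = U * linkSign E e := by
  unfold linkSign
  split_ifs
  · exact negOne_mul_comm U
  · rw [one_mul, mul_one]

/-- `(σ U)⁻¹ = σ U⁻¹` for a link sign `σ`. [folklore] -/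
private theorem linkSign_mul_inv (E : Finset (Edge d L)) (e : Edge d L) (U : SU2) :
    (linkSign E e * U)⁻¹ = linkSign E e * U⁻¹ := by
  unfold linkSign
  split_ifs
  · exact negOne_mul_inv U
  · rw [one_mul, one_mul]

/-- The link flip is an involution of the configuration space. [folklore] -/
private theorem flipLinks_flipLinks (E : Finset (Edge d L)) (U : GaugeConfig d L SU2) :
    flipLinks E (flipLinks E U) = U := by
  funext e
  simp only [flipLinks, ← mul_assoc, linkSign_mul_linkSign, one_mul]

/-- The product of the four link signs around the plaquette at `x` in the `(i, j)` plane (boundary slots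
`(x,i)`, `(x+eᵢ,j)`, `(x+eⱼ,i)`, `(x,j)`). [folklore] -/
def plaqSign (E : Finset (Edge d L)) (x : Site d L) (i j : Fin d) : SU2 :=
  linkSign E (x, i) * linkSign E (x.shift i, j) * linkSign E (x.shift j, i) * linkSign E (x, j)

/-- **The flipped holonomy**: under `U_b ↦ -U_b` (`b ∈ E`) the plaquette holonomy
`U_p = U(x,i) U(x+eᵢ,j) U(x+eⱼ,i)⁻¹ U(x,j)⁻¹` is multiplied by the (central) product of the four link
signs of its boundary. [cite: Tomboulis2007Confinement, §4 (text after (4.1))] -/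
theorem plaquetteHolonomy_flipLinks (E : Finset (Edge d L)) (U : GaugeConfig d L SU2)
    (x : Site d L) (i j : Fin d) :
    plaquetteHolonomy (flipLinks E U) x i j = plaqSign E x i j * plaquetteHolonomy U x i j := by
  simp only [plaquetteHolonomy, flipLinks, plaqSign, linkSign_mul_inv]
  -- move the central signs to the front
  set s₁ := linkSign E (x, i)
  set s₂ := linkSign E (x.shift i, j)
  set s₃ := linkSign E (x.shift j, i)
  set s₄ := linkSign E (x, j)
  have h₂ : ∀ V : SU2, s₂ * V = V * s₂ := linkSign_mul_comm E _
  have h₃ : ∀ V : SU2, s₃ * V = V * s₃ := linkSign_mul_comm E _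
  have h₄ : ∀ V : SU2, s₄ * V = V * s₄ := linkSign_mul_comm E _
  calc s₁ * U (x, i) * (s₂ * U (x.shift i, j)) * (s₃ * (U (x.shift j, i))⁻¹) * (s₄ * (U (x, j))⁻¹)
      = s₁ * (U (x, i) * s₂) * U (x.shift i, j) * s₃ * (U (x.shift j, i))⁻¹ * s₄ * (U (x, j))⁻¹ := by
        simp only [mul_assoc]
    _ = s₁ * (s₂ * U (x, i)) * U (x.shift i, j) * s₃ * (U (x.shift j, i))⁻¹ * s₄ * (U (x, j))⁻¹ := by
        rw [h₂]
    _ = s₁ * s₂ * (U (x, i) * U (x.shift i, j) * s₃) * (U (x.shift j, i))⁻¹ * s₄ * (U (x, j))⁻¹ := by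
        simp only [mul_assoc]
    _ = s₁ * s₂ * (s₃ * (U (x, i) * U (x.shift i, j))) * (U (x.shift j, i))⁻¹ * s₄ * (U (x, j))⁻¹ := by
        rw [h₃]
    _ = s₁ * s₂ * s₃ * (U (x, i) * U (x.shift i, j) * (U (x.shift j, i))⁻¹ * s₄) * (U (x, j))⁻¹ := by
        simp only [mul_assoc]
    _ = s₁ * s₂ * s₃ * (s₄ * (U (x, i) * U (x.shift i, j) * (U (x.shift j, i))⁻¹)) * (U (x, j))⁻¹ := by
        rw [h₄]
    _ = s₁ * s₂ * s₃ * s₄ * (U (x, i) * U (x.shift i, j) * (U (x.shift j, i))⁻¹ * (U (x, j))⁻¹) := by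
        simp only [mul_assoc]

/-! ### Parity of the plaquette sign; the mod-2 coboundary of a link set -/

/-- Indicator of a link set, as a natural number. [folklore] -/
def linkInd (E : Finset (Edge d L)) (e : Edge d L) : ℕ := if e ∈ E then 1 else 0

/-- The number `k_p(E)` of boundary slots of the plaquette `p = (x; i, j)` — its links `(x,i)`, `(x+eᵢ,j)`,
`(x+eⱼ,i)`, `(x,j)`, counted WITH multiplicity (on the torus of side `1` a plaquette traverses each of its
links twice) — that lie in `E`. [folklore] -/
def flipCount (E : Finset (Edge d L)) (x : Site d L) (i j : Fin d) : ℕ :=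
  linkInd E (x, i) + linkInd E (x.shift i, j) + linkInd E (x.shift j, i) + linkInd E (x, j)

/-- `σ_E(e) = (-𝟙)^{𝟙_E(e)}`. [folklore] -/
private theorem linkSign_eq_pow (E : Finset (Edge d L)) (e : Edge d L) :
    linkSign E e = negOne ^ linkInd E e := by
  unfold linkSign linkInd
  split_ifs <;> simp

/-- The plaquette sign is `(-𝟙)^{k_p(E)}`. [folklore] -/
private theorem plaqSign_eq_pow (E : Finset (Edge d L)) (x : Site d L) (i j : Fin d) :
    plaqSign E x i j = negOne ^ flipCount E x i j := by
  simp only [plaqSign, flipCount, linkSign_eq_pow, pow_add]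

/-- `(-𝟙)^k = 𝟙` for even `k`. [folklore] -/
private theorem negOne_pow_of_even {k : ℕ} (hk : Even k) : (negOne : SU2) ^ k = 1 := by
  obtain ⟨m, rfl⟩ := hk
  rw [← two_mul, pow_mul, pow_two, negOne_mul_negOne, one_pow]

/-- `(-𝟙)^k = -𝟙` for odd `k`. [folklore] -/
private theorem negOne_pow_of_odd {k : ℕ} (hk : Odd k) : (negOne : SU2) ^ k = negOne := by
  obtain ⟨m, rfl⟩ := hk
  rw [pow_succ, pow_mul, pow_two, negOne_mul_negOne, one_pow, one_mul]

variable [NeZero L]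

/-- **The mod-2 coboundary `δE` of a link set `E`**: the plaquettes with an odd number `k_p(E)` of boundary
slots in `E` (the coboundary of the cellular cochain complex of the torus with `ℤ/2` coefficients, a
1-cochain being a set of links and a 2-cochain a set of plaquettes; Tomboulis: "a set of bonds cobounded
by `𝒱 ∪ 𝒱'`"). [folklore] -/
def coboundary (E : Finset (Edge d L)) : Finset (Plaquette d L) :=
  Finset.univ.filter fun p => Odd (flipCount E p.1 p.2.1.1 p.2.1.2)

/-- Membership in the mod-2 coboundary: `p ∈ δE` iff `p` has an odd number of boundary slots in `E`
("mod 2 conservation of flux", arXiv:0707.2179 §4). [cite: Tomboulis2007Confinement, §4 (text after eq. (4.1))] -/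
theorem mem_coboundary (E : Finset (Edge d L)) (p : Plaquette d L) :
    p ∈ coboundary E ↔ Odd (flipCount E p.1 p.2.1.1 p.2.1.2) := by
  simp [coboundary]

/-! ### Haar invariance of the link flip and the mod-2 rule -/

/-- **The change of variables `U_b ↦ -U_b` preserves the product Haar measure** `∏_b dU_b`: link by link
it is the left translation by `-𝟙` or by `𝟙`, which preserves the Haar probability measure of the compact
group `SU(2)`, and `Measure.pi` is preserved factorwise (Mathlib `measurePreserving_pi`).
[cite: Tomboulis2007Confinement, §4 (text after (4.1))] -/
theorem measurePreserving_flipLinks (E : Finset (Edge d L)) :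
    MeasurePreserving (flipLinks E)
      (Measure.pi fun _ : Edge d L => haarProbability SU2)
      (Measure.pi fun _ : Edge d L => haarProbability SU2) :=
  measurePreserving_pi (f := fun (e : Edge d L) (x : SU2) => linkSign E e * x)
    (fun _ : Edge d L => haarProbability SU2) (fun _ : Edge d L => haarProbability SU2)
    fun e => measurePreserving_mul_left (haarProbability SU2) (linkSign E e)

/-- The link flip as a measurable involution of the configuration space `SU(2)^{links}`. [folklore] -/
def flipEquiv (E : Finset (Edge d L)) : GaugeConfig d L SU2 ≃ᵐ GaugeConfig d L SU2 where
  toFun := flipLinks E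
  invFun := flipLinks E
  left_inv := flipLinks_flipLinks E
  right_inv := flipLinks_flipLinks E
  measurable_toFun := (measurePreserving_flipLinks E).measurable
  measurable_invFun := (measurePreserving_flipLinks E).measurable

variable (d L)

/-- **Tomboulis's mod-2 rule: the twisted partition function depends on the twist set only modulo
coboundaries.** For every spin cut-off `J`, coefficient sequence `c`, plaquette set `V` and link set `E` of
the torus `(ℤ/Lℤ)^d`: `Z⁻_{V ∆ δE}({c_j}) = Z⁻_V({c_j})`. Proof as printed (arXiv:0707.2179 §4, text
after (4.1): "a twist … on a coclosed set `𝒱` can be moved to … any other homologous coclosed set `𝒱'` by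
the change of variables `U_b → -U_b` for each bond `b` in a set of bonds cobounded by `𝒱 ∪ 𝒱'`, leaving
`Z_Λ(τ, β)` invariant"): substitute `U ↦ flipLinks E U` in the Haar integral
(`measurePreserving_flipLinks`); the holonomy of `p` picks up `(-𝟙)^{k_p(E)}`
(`plaquetteHolonomy_flipLinks`), which for odd `k_p(E)` exchanges `f` and `f⁻` (`plaqFn_negOne_mul`,
`plaqFnTwist_negOne_mul`) and for even `k_p(E)` does nothing. No hypothesis on `c`, `J`, `d`, `L`.
[cite: Tomboulis2007Confinement, §4 (text after eq. (4.1))] -/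
theorem torusZtw_symmDiff_coboundary (J : ℕ) (c : ℕ → ℝ) (V : Finset (Plaquette d L))
    (E : Finset (Edge d L)) :
    torusZtw d L J c (V ∆ coboundary E) = torusZtw d L J c V := by
  have hmp : MeasurePreserving (flipEquiv E)
      (Measure.pi fun _ : Edge d L => haarProbability SU2)
      (Measure.pi fun _ : Edge d L => haarProbability SU2) :=
    measurePreserving_flipLinks E
  unfold torusZtw
  refine Eq.trans ?_ (hmp.integral_comp' (fun U : GaugeConfig d L SU2 => ∏ p : Plaquette d L,
      (if p ∈ V then plaqFnTwist J c (plaquetteHolonomy U p.1 p.2.1.1 p.2.1.2)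
        else plaqFn J c (plaquetteHolonomy U p.1 p.2.1.1 p.2.1.2))))
  congr 1
  funext U
  refine Finset.prod_congr rfl fun p _ => ?_
  change _ = (if p ∈ V then plaqFnTwist J c (plaquetteHolonomy (flipLinks E U) p.1 p.2.1.1 p.2.1.2)
      else plaqFn J c (plaquetteHolonomy (flipLinks E U) p.1 p.2.1.1 p.2.1.2))
  rw [plaquetteHolonomy_flipLinks, plaqSign_eq_pow]
  rcases Nat.even_or_odd (flipCount E p.1 p.2.1.1 p.2.1.2) with he | ho
  · have hp : p ∉ coboundary E := by
      rw [mem_coboundary]; exact Nat.not_odd_iff_even.mpr he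
    rw [negOne_pow_of_even he, one_mul]
    by_cases hV : p ∈ V
    · rw [if_pos (Finset.mem_symmDiff.mpr (Or.inl ⟨hV, hp⟩)), if_pos hV]
    · have h' : p ∉ V ∆ coboundary E := by
        rw [Finset.mem_symmDiff]; tauto
      rw [if_neg h', if_neg hV]
  · have hp : p ∈ coboundary E := (mem_coboundary E p).mpr ho
    rw [negOne_pow_of_odd ho]
    by_cases hV : p ∈ V
    · have h' : p ∉ V ∆ coboundary E := by
        rw [Finset.mem_symmDiff]; tauto
      rw [if_neg h', if_pos hV, plaqFnTwist_negOne_mul]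
    · rw [if_pos (Finset.mem_symmDiff.mpr (Or.inr ⟨hp, hV⟩)), if_neg hV, plaqFn_negOne_mul]

/-- **A twist carried by a coboundary is invisible**: `Z⁻_{δE}({c_j}) = Z({c_j})` (the case `V = ∅` of the
mod-2 rule; e.g. twisting the `2(d-1)` plaquettes around one link does nothing).
[cite: Tomboulis2007Confinement, §4 (text after eq. (4.1))] -/
theorem torusZtw_coboundary (J : ℕ) (c : ℕ → ℝ) (E : Finset (Edge d L)) :
    torusZtw d L J c (coboundary E) = torusZ d L J c := by
  rw [← torusZtw_empty d L J c, ← torusZtw_symmDiff_coboundary d L J c ∅ E]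
  congr 1
  ext p
  simp [Finset.mem_symmDiff]

/-! ### Coboundaries add up mod 2 -/

variable {d L} in
omit [NeZero L] in
/-- `𝟙_{E ∆ E'} ≡ 𝟙_E + 𝟙_{E'} (mod 2)`. [folklore] -/
private theorem natCast_linkInd_symmDiff (E E' : Finset (Edge d L)) (e : Edge d L) :
    ((linkInd (E ∆ E') e : ℕ) : ZMod 2) = (linkInd E e : ZMod 2) + (linkInd E' e : ZMod 2) := by
  unfold linkInd
  by_cases h : e ∈ E <;> by_cases h' : e ∈ E' <;> simp [h, h', Finset.mem_symmDiff]
  decide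

variable {d L} in
omit [NeZero L] in
/-- `k_p(E ∆ E') ≡ k_p(E) + k_p(E') (mod 2)`. [folklore] -/
private theorem natCast_flipCount_symmDiff (E E' : Finset (Edge d L)) (x : Site d L) (i j : Fin d) :
    ((flipCount (E ∆ E') x i j : ℕ) : ZMod 2) =
      (flipCount E x i j : ZMod 2) + (flipCount E' x i j : ZMod 2) := by
  simp only [flipCount, Nat.cast_add, natCast_linkInd_symmDiff]
  ring

/-- **The mod-2 coboundary is additive**: `δ(E ∆ E') = δE ∆ δE'` — flipping along `E` and then along `E'`
is flipping along `E ∆ E'` ("mod 2 conservation of flux", arXiv:0707.2179 §4).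
[cite: Tomboulis2007Confinement, §4 (text after eq. (4.1))] -/
theorem coboundary_symmDiff (E E' : Finset (Edge d L)) :
    coboundary (E ∆ E') = coboundary E ∆ coboundary E' := by
  ext p
  rw [Finset.mem_symmDiff, mem_coboundary, mem_coboundary, mem_coboundary,
    ← ZMod.natCast_eq_one_iff_odd, ← ZMod.natCast_eq_one_iff_odd, ← ZMod.natCast_eq_one_iff_odd,
    natCast_flipCount_symmDiff]
  generalize (flipCount E p.1 p.2.1.1 p.2.1.2 : ZMod 2) = a
  generalize (flipCount E' p.1 p.2.1.1 p.2.1.2 : ZMod 2) = b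
  revert a b
  decide

/-- **The mod-2 rule, symmetric form**: twist sets `V`, `W` "cobounding a set of bonds `E`"
(`V ∆ W = δE`) give the same twisted partition function, `Z⁻_V = Z⁻_W`.
[cite: Tomboulis2007Confinement, §4 (text after eq. (4.1))] -/
theorem torusZtw_congr_coboundary (J : ℕ) (c : ℕ → ℝ) {V W : Finset (Plaquette d L)}
    (E : Finset (Edge d L)) (h : V ∆ W = coboundary E) :
    torusZtw d L J c V = torusZtw d L J c W := by
  have hW : W = V ∆ coboundary E := by
    rw [← h, ← symmDiff_assoc, symmDiff_self, bot_symmDiff]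
  rw [hW, torusZtw_symmDiff_coboundary]

/-! ### Even tori: the set of all plaquettes is a coboundary; the centre symmetry -/

/-- For even `L`: **the odd staircase** — the links `(x, m)` with `x₀ + ⋯ + x_{m-1}` odd, the parity
being read through the reduction `ℤ/L → ℤ/2` (which exists exactly when `L` is even). It meets every
plaquette in an odd number (one or three) of boundary slots (`flipCount_oddStaircase_odd`), so its
coboundary is the set of ALL plaquettes, in every dimension `d`; compare Li–Meurice, Phys. Rev. D 71 (2005)
016008, §3 and Appendix: "for `D ≤ 4` and for `L` even, it is possible to construct a set of lines on the
lattice such that every plaquette shares one and only one link with this set", used in §4 for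
`Z(-β) = e^{2β𝒩_p} Z(β)` ("since `-𝟙` is an element of `SU(2)` and since the Haar measure is invariant under
left or right multiplication by a group element, this does not affect the measure of integration").
[cite: LiMeurice2004, §3–§4 and Appendix] -/
def oddStaircase (hL : 2 ∣ L) : Finset (Edge d L) :=
  Finset.univ.filter fun e => ZMod.castHom hL (ZMod 2) (∑ k ∈ Finset.Iio e.2, e.1 k) = 1

variable {d L} in
/-- Membership in the odd staircase. [folklore] -/
private theorem mem_oddStaircase (hL : 2 ∣ L) (y : Site d L) (m : Fin d) :
    (y, m) ∈ oddStaircase d L hL ↔ ZMod.castHom hL (ZMod 2) (∑ k ∈ Finset.Iio m, y k) = 1 := by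
  unfold oddStaircase
  rw [Finset.mem_filter]
  simp only [Finset.mem_univ, true_and]

variable {d L} in
/-- **Every plaquette has an odd number of boundary slots in the odd staircase**: for the plaquette
`(y; i, j)`, `i < j`, the slots `(y,i)` and `(y+eⱼ,i)` carry the same parity `y₀+⋯+y_{i-1}` (as `j > i`),
while `(y,j)` and `(y+eᵢ,j)` carry the parities `y₀+⋯+y_{j-1}` and `y₀+⋯+y_{j-1}+1` (as `i < j`), exactly
one of which is odd. [folklore] -/
private theorem flipCount_oddStaircase_odd (hL : 2 ∣ L) (x : Site d L) {i j : Fin d} (hij : i < j) :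
    Odd (flipCount (oddStaircase d L hL) x i j) := by
  have hA : (∑ k ∈ Finset.Iio i, (x.shift j) k) = ∑ k ∈ Finset.Iio i, x k := by
    refine Finset.sum_congr rfl fun k hk => ?_
    have hk' : k < i := Finset.mem_Iio.mp hk
    have hkj : k ≠ j := fun h => lt_asymm hij (h ▸ hk')
    simp [Site.shift, hkj]
  have hB : (∑ k ∈ Finset.Iio j, (x.shift i) k) = (∑ k ∈ Finset.Iio j, x k) + 1 := by
    simp only [Site.shift, Pi.add_apply, Finset.sum_add_distrib]
    congr 1
    rw [Finset.sum_pi_single']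
    simp [hij]
  rw [← ZMod.natCast_eq_one_iff_odd]
  simp only [flipCount, linkInd, Nat.cast_add, Nat.cast_ite, Nat.cast_one, Nat.cast_zero,
    mem_oddStaircase, hA, hB, map_add, map_one]
  generalize ZMod.castHom hL (ZMod 2) (∑ k ∈ Finset.Iio i, x k) = a
  generalize ZMod.castHom hL (ZMod 2) (∑ k ∈ Finset.Iio j, x k) = b
  revert a b
  decide

/-- **On an even torus the set of all plaquettes is a coboundary** (of the odd staircase).
[cite: LiMeurice2004, §4] -/
theorem coboundary_oddStaircase (hL : 2 ∣ L) :
    coboundary (oddStaircase d L hL) = Finset.univ := by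
  ext p
  simp only [Finset.mem_univ, iff_true, mem_coboundary]
  exact flipCount_oddStaircase_odd hL p.1 p.2.2

/-- **Even tori: complementary twist sets give the same partition function**, `Z⁻_{Vᶜ}({c_j}) = Z⁻_V({c_j})`
for `2 ∣ L` (`Vᶜ = V ∆ δ(odd staircase)`). [cite: Tomboulis2007Confinement, §4 (text after eq. (4.1))] -/
theorem torusZtw_compl_of_even (hL : 2 ∣ L) (J : ℕ) (c : ℕ → ℝ) (V : Finset (Plaquette d L)) :
    torusZtw d L J c Vᶜ = torusZtw d L J c V := by
  rw [← torusZtw_symmDiff_coboundary d L J c V (oddStaircase d L hL), coboundary_oddStaircase]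
  congr 1
  ext p
  simp [Finset.mem_symmDiff]

/-- **Even tori: twisting every plaquette does nothing**, `Z⁻_{all plaquettes}({c_j}) = Z({c_j})` for
`2 ∣ L`. [cite: Tomboulis2007Confinement, §4 (text after eq. (4.1))] -/
theorem torusZtw_univ_of_even (hL : 2 ∣ L) (J : ℕ) (c : ℕ → ℝ) :
    torusZtw d L J c Finset.univ = torusZ d L J c := by
  rw [← coboundary_oddStaircase d L hL, torusZtw_coboundary]

/-- **Even tori: the centre flip of the coefficients is a symmetry of every twisted partition function**,
`Z⁻_V({(-1)^{2j} c_j}) = Z⁻_V({c_j})` for `2 ∣ L`, every `J`, `c`, `V` (`torusZtw_negOdd`: the flip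
complements the twist set; `torusZtw_compl_of_even`). For the Wilson coefficients
`c_j(β) = I_{2j+1}(β)/I_1(β)` the flip is `β ↦ -β`: Li–Meurice's symmetry `Z(-β) = e^{2β𝒩_p} Z(β)` of
`SU(2)` lattice gauge theory on even lattices, in Tomboulis's normalisation. [cite: LiMeurice2004, §4] -/
theorem torusZtw_negOdd_of_even (hL : 2 ∣ L) (J : ℕ) (c : ℕ → ℝ) (V : Finset (Plaquette d L)) :
    torusZtw d L J (fun n => (-1 : ℝ) ^ n * c n) V = torusZtw d L J c V := by
  rw [torusZtw_negOdd, torusZtw_compl_of_even d L hL]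

/-- **Even tori: `Z({(-1)^{2j} c_j}) = Z({c_j})`** for `2 ∣ L` (Li–Meurice's `β ↦ -β` symmetry in
Tomboulis's normalisation; no condition on the coefficients). [cite: LiMeurice2004, §4] -/
theorem torusZ_negOdd_of_even (hL : 2 ∣ L) (J : ℕ) (c : ℕ → ℝ) :
    torusZ d L J (fun n => (-1 : ℝ) ^ n * c n) = torusZ d L J c := by
  rw [torusZ_negOdd, torusZtw_univ_of_even d L hL]

/-- **Even tori, one-character ray (`J = 1`, `f = 1 + 2sχ_{1/2}`): `Z(-s) = Z(s)`** — the partition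
function is an even function of `s` (census parity law, evenness rows on `2³`, `4³`, `2⁴`).
[cite: LiMeurice2004, §4] -/
theorem torusZ_one_scaleCoeff_neg_of_even (hL : 2 ∣ L) (c : ℕ → ℝ) (α : ℝ) :
    torusZ d L 1 (scaleCoeff (-α) c) = torusZ d L 1 (scaleCoeff α c) := by
  rw [torusZ_one_scaleCoeff_neg, torusZtw_univ_of_even d L hL]

/-- **Even tori, one-character ray: `Z⁻_V(-s) = Z⁻_V(s)`** for every twist set `V`.
[cite: LiMeurice2004, §4] -/
theorem torusZtw_one_scaleCoeff_neg_of_even (hL : 2 ∣ L) (c : ℕ → ℝ) (α : ℝ)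
    (V : Finset (Plaquette d L)) :
    torusZtw d L 1 (scaleCoeff (-α) c) V = torusZtw d L 1 (scaleCoeff α c) V := by
  rw [torusZtw_one_scaleCoeff_neg, torusZtw_compl_of_even d L hL]

/-- **Even tori, one-character ray: the vortex free-energy ratio `Z⁻_V/Z` is an even function of `s`.**
[cite: LiMeurice2004, §4] -/
theorem vortexRatio_one_scaleCoeff_neg_of_even (hL : 2 ∣ L) (c : ℕ → ℝ) (α : ℝ)
    (V : Finset (Plaquette d L)) :
    vortexRatio d L 1 (scaleCoeff (-α) c) V = vortexRatio d L 1 (scaleCoeff α c) V := by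
  unfold vortexRatio
  rw [torusZ_one_scaleCoeff_neg_of_even d L hL, torusZtw_one_scaleCoeff_neg_of_even d L hL]

/-! ### Parallel vortex sheets: location independence and cancellation in pairs -/

variable {d}

/-- **The vortex sheet of the `(i, j)` plane at position `x_i = a`** (`x_j = 0`): all `(i, j)`-plaquettes
whose base point has `i`-coordinate `a` and `j`-coordinate `0` — a coclosed set winding around the torus
in the `d - 2` directions perpendicular to the plane, the translate by `a eᵢ` of Tomboulis's `𝒱_{ij}`
(`vortexSheet` is the sheet at `a = 0`, `vortexSheetAt_zero`).
[cite: Tomboulis2007Confinement, §4 (the set 𝒱_{μν})] -/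
def vortexSheetAt (a : ZMod L) (i j : Fin d) (hij : i < j) : Finset (Plaquette d L) :=
  Finset.univ.filter fun p => p.2 = ⟨(i, j), hij⟩ ∧ p.1 i = a ∧ p.1 j = 0

/-- **The bonds cobounded by two adjacent parallel sheets**: the `j`-links `(x, j)` with `x_i = a + 1`,
`x_j = 0` (between the sheets at `a` and `a + 1`).
[cite: Tomboulis2007Confinement, §4 (text after eq. (4.1): "a set of bonds cobounded by 𝒱 ∪ 𝒱′")] -/
def sheetLinks (a : ZMod L) (i j : Fin d) : Finset (Edge d L) :=
  Finset.univ.filter fun e => e.2 = j ∧ e.1 i = a + 1 ∧ e.1 j = 0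

/-- The sheet at position `0` is Tomboulis's `vortexSheet` `𝒱_{ij}`. [cite: Tomboulis2007Confinement, §4 (the set 𝒱_{μν})] -/
theorem vortexSheetAt_zero (i j : Fin d) (hij : i < j) :
    vortexSheetAt L 0 i j hij = vortexSheet L i j hij := rfl

variable {L}

/-- Membership in a translated sheet. [folklore] -/
private theorem mem_vortexSheetAt (a : ZMod L) {i j : Fin d} (hij : i < j) (y : Site d L)
    (q : {p : Fin d × Fin d // p.1 < p.2}) :
    (y, q) ∈ vortexSheetAt L a i j hij ↔ q = ⟨(i, j), hij⟩ ∧ y i = a ∧ y j = 0 := by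
  unfold vortexSheetAt
  rw [Finset.mem_filter]
  simp only [Finset.mem_univ, true_and]

/-- Membership in the link set between two adjacent sheets. [folklore] -/
private theorem mem_sheetLinks (a : ZMod L) (i j : Fin d) (y : Site d L) (m : Fin d) :
    (y, m) ∈ sheetLinks L a i j ↔ m = j ∧ y i = a + 1 ∧ y j = 0 := by
  unfold sheetLinks
  rw [Finset.mem_filter]
  simp only [Finset.mem_univ, true_and]

omit [NeZero L] in
/-- `𝟙_P + 𝟙_Q` is odd iff exactly one of `P`, `Q` holds (plumbing). [folklore] -/
private theorem odd_ite_add_ite (P Q : Prop) [Decidable P] [Decidable Q] :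
    Odd ((if P then 1 else 0) + (if Q then 1 else 0) : ℕ) ↔ (P ∧ ¬Q ∨ Q ∧ ¬P) := by
  by_cases hP : P <;> by_cases hQ : Q <;> simp [hP, hQ, Nat.odd_iff]

omit [NeZero L] in
/-- `𝟙_P + 𝟙_P` is even (plumbing). [folklore] -/
private theorem not_odd_ite_add_self (P : Prop) [Decidable P] :
    ¬Odd ((if P then 1 else 0) + (if P then 1 else 0) : ℕ) := by
  by_cases hP : P <;> simp [hP, Nat.odd_iff]

/-- **The coboundary of the bonds between two adjacent parallel sheets is that pair of sheets**:
`δ(sheetLinks a) = 𝒱(a) ∆ 𝒱(a+1)`. (In the `(i, j)` plane the link `(x, j)`, `x_i = a + 1`, bounds the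
plaquettes at `x_i = a` and `x_i = a + 1`; in a `(j, k)` or `(k, j)` plane, `k ≠ i`, the two `j`-links of
a plaquette have the same `i`- and `j`-coordinates, so they lie in the set together; other planes contain
no `j`-links. On the torus of side `1` both sides are empty.)
[cite: Tomboulis2007Confinement, §4 (text after eq. (4.1))] -/
theorem coboundary_sheetLinks (a : ZMod L) {i j : Fin d} (hij : i < j) :
    coboundary (sheetLinks L a i j) = vortexSheetAt L a i j hij ∆ vortexSheetAt L (a + 1) i j hij := by
  ext p
  rcases p with ⟨y, ⟨⟨a', b'⟩, hab⟩⟩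
  rw [mem_coboundary, Finset.mem_symmDiff, mem_vortexSheetAt, mem_vortexSheetAt]
  simp only [flipCount, linkInd, mem_sheetLinks]
  by_cases hb : b' = j
  · subst hb
    by_cases ha : a' = i
    · subst ha
      have h1 : (y.shift a') a' = y a' + 1 := by simp [Site.shift]
      have h2 : (y.shift a') b' = y b' := by simp [Site.shift, Pi.single_eq_of_ne hij.ne']
      simp only [h1, h2, hij.ne, false_and, if_false, zero_add, add_zero, add_left_inj, true_and]
      exact odd_ite_add_ite _ _
    · have hne : ¬((⟨(a', b'), hab⟩ : {p : Fin d × Fin d // p.1 < p.2}) = ⟨(i, b'), hij⟩) := by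
        intro h
        exact ha (congrArg (fun q : {p : Fin d × Fin d // p.1 < p.2} => q.1.1) h)
      have h1 : (y.shift a') i = y i := by simp [Site.shift, Pi.single_eq_of_ne (Ne.symm ha)]
      have h2 : (y.shift a') b' = y b' := by simp [Site.shift, Pi.single_eq_of_ne hab.ne']
      simp only [h1, h2, hab.ne, hne, false_and, if_false, zero_add, add_zero, true_and, not_false_iff,
        and_true, or_self, iff_false]
      exact not_odd_ite_add_self _
  · by_cases ha : a' = j
    · subst ha
      have hne : ¬((⟨(a', b'), hab⟩ : {p : Fin d × Fin d // p.1 < p.2}) = ⟨(i, a'), hij⟩) := by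
        intro h
        exact hb (congrArg (fun q : {p : Fin d × Fin d // p.1 < p.2} => q.1.2) h)
      have h1 : (y.shift b') i = y i := by
        simp [Site.shift, Pi.single_eq_of_ne (hij.trans hab).ne]
      have h2 : (y.shift b') a' = y a' := by simp [Site.shift, Pi.single_eq_of_ne hab.ne]
      simp only [h1, h2, hb, hne, false_and, if_false, add_zero, true_and, not_false_iff,
        and_true, or_self, iff_false]
      exact not_odd_ite_add_self _
    · have hne : ¬((⟨(a', b'), hab⟩ : {p : Fin d × Fin d // p.1 < p.2}) = ⟨(i, j), hij⟩) := by
        intro h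
        exact hb (congrArg (fun q : {p : Fin d × Fin d // p.1 < p.2} => q.1.2) h)
      simp [ha, hb, hne]

/-- The coboundary of the empty link set is empty. [folklore] -/
private theorem coboundary_empty : coboundary (∅ : Finset (Edge d L)) = ∅ := by
  ext p
  simp [mem_coboundary, flipCount, linkInd]

/-- **Two parallel sheets cobound a set of bonds**: for every `a` and `n`, the pair of sheets at positions
`a` and `a + n` is the coboundary of the bonds in between (`sheetLinks a ∆ ⋯ ∆ sheetLinks (a+n-1)`).
[cite: Tomboulis2007Confinement, §4 (text after eq. (4.1))] -/
theorem exists_coboundary_eq_two_sheets (a : ZMod L) {i j : Fin d} (hij : i < j) (n : ℕ) :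
    ∃ E : Finset (Edge d L),
      coboundary E = vortexSheetAt L a i j hij ∆ vortexSheetAt L (a + (n : ZMod L)) i j hij := by
  induction n with
  | zero =>
    refine ⟨∅, ?_⟩
    rw [coboundary_empty, Nat.cast_zero, add_zero, symmDiff_self]
    rfl
  | succ n ih =>
    obtain ⟨E, hE⟩ := ih
    refine ⟨E ∆ sheetLinks L (a + (n : ZMod L)) i j, ?_⟩
    rw [coboundary_symmDiff, hE, coboundary_sheetLinks (a + (n : ZMod L)) hij, Nat.cast_succ, ← add_assoc,
      symmDiff_assoc, symmDiff_symmDiff_cancel_left]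

variable (L)

/-- **Tomboulis §4: twists on two homologous (parallel) vortex sheets cancel** — "`Z_Λ(τ_{μν}, β)` is
invariant under changes mod 2 in the number of homologous coclosed sets in `Λ` carrying a twist": the
partition function twisted on the sheets of the `(i, j)` plane at positions `a` and `b` is the untwisted
one, for `a ≠ b` (two sheets) as for `a = b` (empty twist set); every `J`, `c`, `d`, `L`.
[cite: Tomboulis2007Confinement, §4 (text after eq. (4.1))] -/
theorem torusZtw_two_parallel_sheets (J : ℕ) (c : ℕ → ℝ) (a b : ZMod L) {i j : Fin d}
    (hij : i < j) :
    torusZtw d L J c (vortexSheetAt L a i j hij ∆ vortexSheetAt L b i j hij) = torusZ d L J c := by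
  obtain ⟨E, hE⟩ := exists_coboundary_eq_two_sheets (L := L) a hij (b - a).val
  rw [ZMod.natCast_zmod_val, add_sub_cancel] at hE
  rw [← hE, torusZtw_coboundary]

/-- **Tomboulis §4: the twisted partition function does not depend on the location of the sheet** —
"depends only on the directions in which `𝒱_{μν}` winds through the lattice, not the exact shape or
location of `𝒱_{μν}`" (also App. A, p. 22: "only the homology class of `𝒱`"), here for the parallel
translates in the `i`-direction: `Z⁻` with the sheet at `x_i = a` equals `Z⁻` with Tomboulis's sheet at
`x_i = 0`; every `J`, `c`, `d`, `L`, `a`. [cite: Tomboulis2007Confinement, §4 (text after eq. (4.1))] -/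
theorem torusZtw_vortexSheetAt (J : ℕ) (c : ℕ → ℝ) (a : ZMod L) {i j : Fin d} (hij : i < j) :
    torusZtw d L J c (vortexSheetAt L a i j hij) = torusZtw d L J c (vortexSheet L i j hij) := by
  obtain ⟨E, hE⟩ := exists_coboundary_eq_two_sheets (L := L) (0 : ZMod L) hij a.val
  rw [ZMod.natCast_zmod_val, zero_add, vortexSheetAt_zero] at hE
  exact (torusZtw_congr_coboundary d L J c E hE.symm).symm

/-- Location independence of the vortex free-energy ratio `Z⁻/Z` along the `i`-direction.
[cite: Tomboulis2007Confinement, §4 (text after eq. (4.1))] -/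
theorem vortexRatio_vortexSheetAt (J : ℕ) (c : ℕ → ℝ) (a : ZMod L) {i j : Fin d} (hij : i < j) :
    vortexRatio d L J c (vortexSheetAt L a i j hij) = vortexRatio d L J c (vortexSheet L i j hij) := by
  unfold vortexRatio
  rw [torusZtw_vortexSheetAt]

/-! ## Revision 2 (append-only): odd tori

The even-`L` half above says that on an even torus the set of all plaquettes is a coboundary. For ODD `L`
it is not (one sheet per plane survives: `L²` parallel translates, an odd number), and the correct statement —
again a consequence of the printed mod-2 rule (arXiv:0707.2179 §4, text after (4.1)) — is that the set of all
plaquettes is cohomologous to ONE SHEET IN EVERY COORDINATE PLANE (`allSheets`, the plaquettes `(x; i, j)`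
with `x_i = x_j = 0`): `coboundary_oddStairs` exhibits the bonds. Consequences (`Odd L`, every `J`, `c`, `d`):
`Z⁻_{all} = Z⁻_{allSheets}` (`torusZtw_univ_of_odd`), `Z⁻_{Vᶜ} = Z⁻_{V ∆ allSheets}` (`torusZtw_compl_of_odd`),
the centre flip `Z⁻_V({(-1)^{2j}c_j}) = Z⁻_{V ∆ allSheets}({c_j})`, `Z({(-1)^{2j}c_j}) = Z⁻_{allSheets}({c_j})`
(`torusZtw_negOdd_of_odd`, `torusZ_negOdd_of_odd`; Li–Meurice, Phys. Rev. D 71 (2005) 016008, §3: "If `L`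
is odd, there will be lines of frustration in every plane"), and on the one-character ray
`Z(-s) = Z⁻_{allSheets}(s)`, `Z⁻_V(-s) = Z⁻_{V ∆ allSheets}(s)` (`torusZ_one_scaleCoeff_neg_of_odd`,
`torusZtw_one_scaleCoeff_neg_of_odd`) — on `3³` the partition function at `-s` is the one twisted on three
mutually orthogonal sheets (the odd case of the census parity law, cell pub-ymgap lit/LIT2-TOMBOULIS-ITOSEILER.md
§I.4). HONEST FRAMING as above: identities of finite Haar integrals, nothing about signs or limits. -/

/-! ### Odd tori: twisting every plaquette = twisting one sheet in every coordinate plane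

For odd `L` the number `L²` of parallel translates of a sheet inside its plane is odd, so the set of ALL
plaquettes of a plane is cohomologous to ONE sheet, and the set of all plaquettes of the torus to the union of
one sheet per coordinate plane (`allSheets`). An explicit set of bonds does it: with
`S = {2, 4, …, L-1} ⊂ ℤ/L` (the non-zero residues with even representative; for odd `L`,
`[v ∈ S] + [v+1 ∈ S] ≡ [v ≠ 0] (mod 2)`), take the links `(x, m)` with an odd number of `k < m` such that
`x_k ∈ S` (`oddStairE`), together with the links `(x, m)` with `x_m = 0` and an odd number of `k > m` such
that `x_k ∈ S` (`oddStairF`). -/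

variable {L}

/-- Indicator (in `ℤ/2`) of the residues `S = {2, 4, …, L-1}`: `v ≠ 0` with even representative
`v.val`. [folklore] -/
def sInd (v : ZMod L) : ZMod 2 := if v ≠ 0 ∧ Even v.val then 1 else 0

/-- For odd `L`: `[v ∈ S] + [v + 1 ∈ S] ≡ [v ≠ 0] (mod 2)` — consecutive non-zero residues have
representatives of opposite parity, `L - 1` is even, and neither `0` nor `1` lies in `S`. [folklore] -/
private theorem sInd_add_sInd_add_one (hL : Odd L) (v : ZMod L) :
    sInd v + sInd (v + 1) = if v = 0 then 0 else 1 := by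
  by_cases hv : v = 0
  · subst hv
    simp only [sInd, ne_eq, not_true_eq_false, false_and, if_false, zero_add, if_true]
    by_cases h1 : (1 : ZMod L) = 0
    · simp [h1]
    · have hL1 : L ≠ 1 := by
        rintro rfl
        exact h1 (Subsingleton.elim _ _)
      haveI : Fact (1 < L) := ⟨by have := NeZero.ne L; omega⟩
      simp [ZMod.val_one]
  · have hn : 0 < v.val := ZMod.val_pos.mpr hv
    have hlt : v.val < L := ZMod.val_lt v
    haveI : Fact (1 < L) := ⟨by omega⟩
    have hval : (v + 1).val = (v.val + 1) % L := by rw [ZMod.val_add, ZMod.val_one]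
    rw [if_neg hv]
    by_cases htop : v.val + 1 = L
    · -- `v = L - 1`: `v + 1 = 0` and `v.val = L - 1` is even
      have h0 : v + 1 = 0 := by
        rw [← ZMod.val_eq_zero, hval, htop, Nat.mod_self]
      have hev : Even v.val := by
        obtain ⟨m, hm⟩ := hL
        exact ⟨m, by omega⟩
      simp [sInd, hv, h0, hev]
    · have hlt' : v.val + 1 < L := by omega
      have hval' : (v + 1).val = v.val + 1 := by rw [hval, Nat.mod_eq_of_lt hlt']
      have hne : v + 1 ≠ 0 := by
        intro h
        have := (ZMod.val_eq_zero (v + 1)).mpr h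
        omega
      rcases Nat.even_or_odd v.val with he | ho
      · have : ¬Even (v + 1).val := by
          rw [hval', Nat.even_add_one]; exact not_not.mpr he
        simp [sInd, hv, hne, he, this]
      · have hno : ¬Even v.val := Nat.not_even_iff_odd.mpr ho
        have : Even (v + 1).val := by
          rw [hval', Nat.even_add_one]; exact hno
        simp [sInd, hv, hne, hno, this]

/-- In `ℤ/2` the indicator of `z = 1` is `z` itself (plumbing). [folklore] -/
private theorem ite_eq_one_zmod_two (z : ZMod 2) : (if z = 1 then (1 : ZMod 2) else 0) = z := by
  revert z; decide

/-- `x + x = 0` in `ℤ/2` (plumbing). [folklore] -/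
private theorem add_self_zmod_two (z : ZMod 2) : z + z = 0 := by
  revert z; decide

omit [NeZero L] in
/-- A shifted site agrees with the site off the shifted coordinate (plumbing). [folklore] -/
private theorem shift_apply_of_ne (y : Site d L) {c k : Fin d} (h : k ≠ c) : (y.shift c) k = y k := by
  simp [Site.shift, Pi.single_eq_of_ne h]

omit [NeZero L] in
/-- The shifted coordinate goes up by one (plumbing). [folklore] -/
private theorem shift_apply_same (y : Site d L) (c : Fin d) : (y.shift c) c = y c + 1 := by
  simp [Site.shift]

omit [NeZero L] in
/-- Sums of `ℤ/2`-valued functions of the coordinates over an index set not containing the shifted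
direction are unchanged by the shift (plumbing). [folklore] -/
private theorem sum_shift_of_not_mem (g : ZMod L → ZMod 2) (y : Site d L) {c : Fin d} {s : Finset (Fin d)}
    (hc : c ∉ s) : ∑ k ∈ s, g ((y.shift c) k) = ∑ k ∈ s, g (y k) := by
  refine Finset.sum_congr rfl fun k hk => ?_
  rw [shift_apply_of_ne y (ne_of_mem_of_not_mem hk hc)]

omit [NeZero L] in
/-- … and over an index set containing it they change by `g(y_c + 1) + g(y_c)` (characteristic two)
(plumbing). [folklore] -/
private theorem sum_shift_of_mem (g : ZMod L → ZMod 2) (y : Site d L) {c : Fin d} {s : Finset (Fin d)}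
    (hc : c ∈ s) : ∑ k ∈ s, g ((y.shift c) k) = ∑ k ∈ s, g (y k) + g (y c + 1) + g (y c) := by
  rw [← Finset.add_sum_erase s _ hc, ← Finset.add_sum_erase s (fun k => g (y k)) hc, shift_apply_same]
  have hrest : ∑ k ∈ s.erase c, g ((y.shift c) k) = ∑ k ∈ s.erase c, g (y k) :=
    Finset.sum_congr rfl fun k hk => by rw [shift_apply_of_ne y (Finset.ne_of_mem_erase hk)]
  rw [hrest]
  linear_combination (-1 : ZMod 2) * add_self_zmod_two (g (y c))

variable (L)

/-- For odd `L`, first family of bonds: the links `(x, m)` with an odd number of coordinates `k < m` in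
`S = {2, 4, …, L-1}`. [folklore] -/
def oddStairE : Finset (Edge d L) :=
  Finset.univ.filter fun e => (∑ k ∈ Finset.Iio e.2, sInd (e.1 k)) = 1

/-- For odd `L`, second family of bonds: the links `(x, m)` with `x_m = 0` and an odd number of
coordinates `k > m` in `S = {2, 4, …, L-1}`. [folklore] -/
def oddStairF : Finset (Edge d L) :=
  Finset.univ.filter fun e => e.1 e.2 = 0 ∧ (∑ k ∈ Finset.Ioi e.2, sInd (e.1 k)) = 1

/-- **One vortex sheet in every coordinate plane**: the plaquettes `(x; i, j)` with `x_i = x_j = 0`, i.e.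
the (disjoint) union over the planes `i < j` of Tomboulis's sheets `𝒱_{ij}` (`vortexSheet L i j`); on
`(ℤ/L)³` these are three mutually orthogonal sheets. [cite: Tomboulis2007Confinement, §4 (the set 𝒱_{μν})] -/
def allSheets : Finset (Plaquette d L) :=
  Finset.univ.filter fun p => p.1 p.2.1.1 = 0 ∧ p.1 p.2.1.2 = 0

variable {L}

/-- Membership in `allSheets` (plumbing). [folklore] -/
private theorem mem_allSheets (y : Site d L) (q : {p : Fin d × Fin d // p.1 < p.2}) :
    (y, q) ∈ allSheets L ↔ y q.1.1 = 0 ∧ y q.1.2 = 0 := by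
  unfold allSheets
  rw [Finset.mem_filter]
  simp only [Finset.mem_univ, true_and]

/-- `allSheets` meets the `(i, j)` plane exactly in Tomboulis's sheet `𝒱_{ij}`.
[cite: Tomboulis2007Confinement, §4 (the set 𝒱_{μν})] -/
theorem vortexSheet_subset_allSheets {i j : Fin d} (hij : i < j) : vortexSheet L i j hij ⊆ allSheets L := by
  intro p hp
  rcases p with ⟨y, q⟩
  unfold vortexSheet at hp
  rw [Finset.mem_filter] at hp
  obtain ⟨_, hq, h0, h1⟩ := hp
  rw [mem_allSheets]
  subst hq
  exact ⟨h0, h1⟩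

/-- The `ℤ/2`-indicator of the first bond family (plumbing). [folklore] -/
private theorem natCast_linkInd_oddStairE (y : Site d L) (m : Fin d) :
    ((linkInd (oddStairE L) (y, m) : ℕ) : ZMod 2) = ∑ k ∈ Finset.Iio m, sInd (y k) := by
  unfold linkInd oddStairE
  simp only [Finset.mem_filter, Finset.mem_univ, true_and, Nat.cast_ite, Nat.cast_one, Nat.cast_zero]
  exact ite_eq_one_zmod_two _

/-- The `ℤ/2`-indicator of the second bond family (plumbing). [folklore] -/
private theorem natCast_linkInd_oddStairF (y : Site d L) (m : Fin d) :
    ((linkInd (oddStairF L) (y, m) : ℕ) : ZMod 2) =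
      if y m = 0 then ∑ k ∈ Finset.Ioi m, sInd (y k) else 0 := by
  unfold linkInd oddStairF
  simp only [Finset.mem_filter, Finset.mem_univ, true_and, Nat.cast_ite, Nat.cast_one, Nat.cast_zero]
  by_cases h : y m = 0
  · simp only [h, true_and, if_true]
    exact ite_eq_one_zmod_two _
  · simp [h]

/-- Parity of the number of boundary slots in the first family: odd iff `y_i ≠ 0` (plumbing). [folklore] -/
private theorem natCast_flipCount_oddStairE (hL : Odd L) (y : Site d L) {i j : Fin d} (hij : i < j) :
    ((flipCount (oddStairE L) y i j : ℕ) : ZMod 2) = if y i = 0 then 0 else 1 := by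
  simp only [flipCount, Nat.cast_add, natCast_linkInd_oddStairE]
  have hjI : j ∉ Finset.Iio i := fun h => lt_asymm hij (Finset.mem_Iio.mp h)
  have hiI : i ∈ Finset.Iio j := Finset.mem_Iio.mpr hij
  rw [sum_shift_of_not_mem sInd y hjI, sum_shift_of_mem sInd y hiI, ← sInd_add_sInd_add_one hL (y i)]
  linear_combination add_self_zmod_two ((∑ k ∈ Finset.Iio i, sInd (y k)) + ∑ k ∈ Finset.Iio j, sInd (y k))

/-- Parity of the number of boundary slots in the second family: odd iff `y_i = 0` and `y_j ≠ 0`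
(plumbing). [folklore] -/
private theorem natCast_flipCount_oddStairF (hL : Odd L) (y : Site d L) {i j : Fin d} (hij : i < j) :
    ((flipCount (oddStairF L) y i j : ℕ) : ZMod 2) = if y i = 0 then (if y j = 0 then 0 else 1) else 0 := by
  have hiJ : i ∉ Finset.Ioi j := fun h => lt_asymm hij (Finset.mem_Ioi.mp h)
  have hjI : j ∈ Finset.Ioi i := Finset.mem_Ioi.mpr hij
  simp only [flipCount, Nat.cast_add, natCast_linkInd_oddStairF, shift_apply_of_ne y hij.ne',
    shift_apply_of_ne y hij.ne, sum_shift_of_not_mem sInd y hiJ, sum_shift_of_mem sInd y hjI]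
  by_cases hi : y i = 0
  · simp only [hi, if_true]
    rw [← sInd_add_sInd_add_one hL (y j)]
    linear_combination add_self_zmod_two
      ((∑ k ∈ Finset.Ioi i, sInd (y k)) + (if y j = 0 then ∑ k ∈ Finset.Ioi j, sInd (y k) else 0))
  · simp only [hi, if_false, zero_add, add_zero]
    linear_combination add_self_zmod_two (if y j = 0 then ∑ k ∈ Finset.Ioi j, sInd (y k) else 0)

/-- **On an odd torus the set of all plaquettes is cohomologous to one sheet per coordinate plane**:
`δ(oddStairE ∆ oddStairF) = (all plaquettes) ∆ allSheets` for odd `L`. [cite: Tomboulis2007Confinement, §4 (text after eq. (4.1))] -/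
theorem coboundary_oddStairs (hL : Odd L) :
    coboundary (oddStairE L ∆ oddStairF L) = (Finset.univ : Finset (Plaquette d L)) ∆ allSheets L := by
  ext p
  rcases p with ⟨y, ⟨⟨a, b⟩, hab⟩⟩
  simp only [mem_coboundary, Finset.mem_symmDiff, Finset.mem_univ, mem_allSheets, true_and,
    not_true_eq_false, and_false, or_false]
  rw [← ZMod.natCast_eq_one_iff_odd, natCast_flipCount_symmDiff, natCast_flipCount_oddStairE hL y hab,
    natCast_flipCount_oddStairF hL y hab]
  by_cases ha : y a = 0 <;> by_cases hb : y b = 0 <;> simp [ha, hb]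

variable (L)

/-- **Odd tori: twisting every plaquette = twisting one sheet in every coordinate plane**,
`Z⁻_{all plaquettes}({c_j}) = Z⁻_{allSheets}({c_j})` for odd `L` (on `(ℤ/L)³`: the three mutually orthogonal
sheets). [cite: Tomboulis2007Confinement, §4 (text after eq. (4.1))] -/
theorem torusZtw_univ_of_odd (hL : Odd L) (J : ℕ) (c : ℕ → ℝ) :
    torusZtw d L J c Finset.univ = torusZtw d L J c (allSheets L) :=
  torusZtw_congr_coboundary d L J c (oddStairE L ∆ oddStairF L) (coboundary_oddStairs hL).symm

/-- Odd tori: complementing the twist set = adding one sheet per coordinate plane,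
`Z⁻_{Vᶜ} = Z⁻_{V ∆ allSheets}`. [cite: Tomboulis2007Confinement, §4 (text after eq. (4.1))] -/
theorem torusZtw_compl_of_odd (hL : Odd L) (J : ℕ) (c : ℕ → ℝ) (V : Finset (Plaquette d L)) :
    torusZtw d L J c Vᶜ = torusZtw d L J c (V ∆ allSheets L) := by
  refine torusZtw_congr_coboundary d L J c (oddStairE L ∆ oddStairF L) ?_
  rw [coboundary_oddStairs hL]
  ext p
  simp only [Finset.mem_symmDiff, Finset.mem_compl, Finset.mem_univ, true_and, not_true_eq_false,
    and_false, or_false]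
  tauto

/-- **Odd tori: the centre flip of the coefficients adds one sheet per coordinate plane to the twist**,
`Z⁻_V({(-1)^{2j} c_j}) = Z⁻_{V ∆ allSheets}({c_j})` for odd `L`. [cite: Tomboulis2007Confinement, §4 (text after eq. (4.1))] -/
theorem torusZtw_negOdd_of_odd (hL : Odd L) (J : ℕ) (c : ℕ → ℝ) (V : Finset (Plaquette d L)) :
    torusZtw d L J (fun n => (-1 : ℝ) ^ n * c n) V = torusZtw d L J c (V ∆ allSheets L) := by
  rw [torusZtw_negOdd, torusZtw_compl_of_odd L hL]

/-- **Odd tori: `Z({(-1)^{2j} c_j}) = Z⁻_{allSheets}({c_j})`** — on an odd lattice `β ↦ -β` is NOT a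
symmetry but maps the partition function to the one twisted on one sheet in every coordinate plane
(cf. Li–Meurice §3: "If `L` is odd, there will be lines of frustration in every plane").
[cite: Tomboulis2007Confinement, §4 (text after eq. (4.1))] -/
theorem torusZ_negOdd_of_odd (hL : Odd L) (J : ℕ) (c : ℕ → ℝ) :
    torusZ d L J (fun n => (-1 : ℝ) ^ n * c n) = torusZtw d L J c (allSheets L) := by
  rw [torusZ_negOdd, torusZtw_univ_of_odd L hL]

/-- **Odd tori, one-character ray: `Z(-s) = Z⁻_{allSheets}(s)`** (on `3³`: `Z(-s)` is the partition function
twisted on three mutually orthogonal sheets — the census parity law, odd case).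
[cite: Tomboulis2007Confinement, §4 (text after eq. (4.1))] -/
theorem torusZ_one_scaleCoeff_neg_of_odd (hL : Odd L) (c : ℕ → ℝ) (α : ℝ) :
    torusZ d L 1 (scaleCoeff (-α) c) = torusZtw d L 1 (scaleCoeff α c) (allSheets L) := by
  rw [torusZ_one_scaleCoeff_neg, torusZtw_univ_of_odd L hL]

/-- Odd tori, one-character ray, twisted: `Z⁻_V(-s) = Z⁻_{V ∆ allSheets}(s)`.
[cite: Tomboulis2007Confinement, §4 (text after eq. (4.1))] -/
theorem torusZtw_one_scaleCoeff_neg_of_odd (hL : Odd L) (c : ℕ → ℝ) (α : ℝ)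
    (V : Finset (Plaquette d L)) :
    torusZtw d L 1 (scaleCoeff (-α) c) V = torusZtw d L 1 (scaleCoeff α c) (V ∆ allSheets L) := by
  rw [torusZtw_one_scaleCoeff_neg, torusZtw_compl_of_odd L hL]

end Tomboulis2007

end Literature.MathematicalPhysics.QuantumFieldTheory

end
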